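import Summits.BirchSwinnertonDyer.Rank1Residual.Supersingular.KobayashiMainConjectureX6BSTWScope
import Summits.BirchSwinnertonDyer.Rank1Residual.Supersingular.X6VisibilityTamDefectShape
import Mathlib.Tactic.NormNum.LegendreSymbol
import HarnessLib

/-!
# Route `SignedLowerHalves`, crux `KobayashiLowerHalfSemistable` (item stmt-BirchSwinnertonDyer-19000): the remaining
# four X6~ rank-0 cells at `p ≥ 5` of the cell window (`145146q1 @ 5`, `236810a1 @ 13`, `297402n1 @ 11`,
# `421511a1 @ 13`) are INSIDE the cell-verified scope of BSTW Thm 1.3 — kernel-checked L-witnesses (cell `bsd-ssimc`,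
# seat `bsd-ssimc-k3-c2` gen 0; companion of `…ScopeB.lean` / `…Scope.lean`; a `--supports … --as helper` file)

PARTITION (cell bsd-ssimc): X6 ∧ r = 0 × the X6~ cells at `p ≥ 5` — with `…Scope.lean` (22678e1@5, 492414f1@5,
130798a1@7) and `…ScopeB.lean` (399190l1@7) this covers ALL EIGHT X6 rank-0 cells of the window at `p ≥ 5` (A6's
22678e1 + the seven X6~ of audit-1's W-bstw-10 row (ii), HOME/bstw/HL-WITNESS-v1.tsv 9d79f7dbfcd62d0f, whose PARI
witnesses agree with these where the same (q, L) was chosen) — types-the-object-of; closes NONE. HONEST FRAMING: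
nothing here proves Kobayashi's conjecture; `BurungaleSkinnerTianWan2024_thm13_scoped_OPEN` is the CELL-VERIFIED
SCOPE of an UNREFEREED preprint (REPORT-bstw-6 + NOTE-W-ref-2 (α)); per pair; NOT bookings; the item stays OPEN.

Data (Cremona minimal models, lane ecdata allcurves; witnesses by the seat's `scripts/s2_witness_search.py`, prime `D`):
* `145146q1 = [1,0,1,−3229945761,−70654953055340]`, `N = 2·3·17·1423`, `Δ = 2²⁷·3¹⁰·17·1423`, `a₅ = 0`; `q = 17`, `L = ℚ(√−71)`, `h = 7`.
* `236810a1 = [1,0,1,−3898227707063,−2962435984809333492]`, `N = 2·5·7·17·199`, `Δ = −2·5·7¹⁷·17⁸·199³`, `a₁₃ = 0`; `q = 17`, `L = ℚ(√−439)`, `h = 15`.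
* `297402n1 = [1,0,1,−227376922,−1319696067412]`, `N = 2·3·7·73·97`, `Δ = −2⁵·3·7¹⁰·73·97`, `a₁₁ = 0`; `q = 97`, `L = ℚ(√−215)` (`215 = 5·43`), `h = 14`.
* `421511a1 = [0,1,1,−1539789408,−23256785654145]`, `N = 307·1373` (odd: G3 active, `−103 ≡ 1 (mod 8)`), `Δ = −307³·1373²`, `a₁₃ = 0`; `q = 307`, `L = ℚ(√−103)`, `h = 5`.

References: [BurungaleSkinnerTianWan2024] Thm 1.3, II §2.3 (PRE); [Kobayashi2003] Conjecture (p. 2); [Cox2013] Thm 2.13 / 7.7(ii); [Cremona2006] Table 1.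
-/

set_option autoImplicit false
set_option linter.dupNamespace false

noncomputable section

namespace Summit.BirchSwinnertonDyer.BirchSwinnertonDyer.Theorems

open scoped Classical

open WeierstrassCurve NumberField Literature.NumberTheory.EllipticCurves
  Literature.NumberTheory.EllipticCurves.Rank1Residual
  Literature.NumberTheory.EllipticCurves.Rank1Residual.X11RankOneCertificates
  Summit.BirchSwinnertonDyer.Rank1Residual.Supersingular
  Summit.BirchSwinnertonDyer.Rank1Residual.X11b
  Summit.BirchSwinnertonDyer.BirchSwinnertonDyer.Rank1Residual.IntModel

/-! ### `145146q1 @ 5` -/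

/-- `#Ẽ(𝔽_5) = 6` for `145146q1` (`a_5 = 0`: good SUPERSINGULAR at `5`; kernel count). [folklore] -/
theorem card_c145146q1_5 :
    Nat.card (((⟨1, 0, 1, -3229945761, -70654953055340⟩ : WeierstrassCurve ℤ).map
      (Int.castRingHom (ZMod 5))).toAffine.Point) = 6 :=
  haveI : Fact (Nat.Prime 5) := ⟨by norm_num⟩
  natCard_point_eq_of_countPoints 1 0 1 (-3229945761) (-70654953055340) 5 (by norm_num) (by decide +kernel)
    (by decide +kernel)

/-- **L-witness for `145146q1` at `p = 5`: `q = 17`, `L = ℚ(√−71)` (`h = 7`)** — `N = 2·3·17·1423`, `Δ_min = 2²⁷·3¹⁰·17·1423`,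
`ord_17 Δ = 1` (`5 ∤ 1`). Unconditional; per pair; closes nothing.
[cite: Cremona2006, Table 1 (Cremona label 145146q1)] [cite: Cox2013, Thm. 2.13 (h(−71) = 7 by reduced forms)] -/
theorem BSTWScope_hasWitness_c145146q1_5 {W : WeierstrassCurve ℚ} [W.IsElliptic] [W.IsGloballyMinimal]
    (hWeq : W = ⟨1, 0, 1, -3229945761, -70654953055340⟩) :
    haveI : Fact (Nat.Prime 5) := ⟨by norm_num⟩
    BSTWScope.HasWitness W 5 := by
  haveI : Fact (Nat.Prime 5) := ⟨by norm_num⟩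
  haveI hq : Fact (Nat.Prime 17) := ⟨by norm_num⟩
  have hIW : integralModelInt W = ⟨1, 0, 1, -3229945761, -70654953055340⟩ :=
    integralModelInt_eq_of_map_eq _ (by rw [hWeq]; ext <;> simp [WeierstrassCurve.map])
  set Lp : List ℕ := [2, 3, 17, 1423] with hLp
  have hLprime : ∀ q ∈ Lp, q.Prime := by
    simp only [hLp, List.mem_cons, List.mem_nil_iff, or_false]
    rintro q (rfl | rfl | rfl | rfl) <;> norm_num
  have hΔE : ∀ q : ℕ, q.Prime → (q : ℤ) ∣ (⟨1, 0, 1, -3229945761, -70654953055340⟩ : WeierstrassCurve ℤ).Δ → q ∈ Lp :=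
    forall_mem_of_natAbs_eq_prod_pow Lp [27, 10, 1, 1] hLprime (by decide +kernel)
  have hbadmem : ∀ ℓ : ℕ, (hℓ : ℓ.Prime) →
      (haveI : Fact ℓ.Prime := ⟨hℓ⟩; ¬ W.HasGoodReductionAtPrime ℓ) → ℓ ∈ Lp := by
    intro ℓ hℓ hbad
    haveI : Fact ℓ.Prime := ⟨hℓ⟩
    have hd := natCast_dvd_minimalDiscriminantInt_of_not_hasGoodReductionAtPrime (W := W) ℓ hbad
    rw [minimalDiscriminantInt_eq hIW] at hd
    exact hΔE ℓ hℓ hd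
  have haux : BSTWScope.IsAuxiliaryPrime W 5 17 := by
    refine ⟨by decide, hasMultiplicativeReductionAtPrime_of_intModel hIW 17 (by decide +kernel)
      (by decide +kernel), ?_⟩
    rw [minimalDiscriminantInt_eq hIW,
      padicValInt_eq_of_dvd_of_not_dvd 17 (e := 1) (by decide +kernel) (by decide +kernel)]
    decide
  refine BSTWScope.hasWitness_of_kronecker W 5 (by decide) 17 haux 71 ⟨by norm_num, ?_, by norm_num⟩
    (by norm_num) (by norm_num) ?_ ?_ (fun _ => by norm_num) ?_
  · exact Int.squarefree_natAbs.mp (by simpa using (by norm_num : Nat.Prime 71).squarefree)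
  · intro ℓ hℓ hbad
    have hmem := hbadmem ℓ hℓ hbad
    simp only [hLp, List.mem_cons, List.mem_nil_iff, or_false] at hmem
    rcases hmem with rfl | rfl | rfl | rfl <;> decide
  · intro ℓ hℓ hℓq hbad
    have hmem := hbadmem ℓ hℓ hbad
    simp only [hLp, List.mem_cons, List.mem_nil_iff, or_false] at hmem
    rcases hmem with rfl | rfl | rfl | rfl
    · exact ⟨fun _ => by norm_num, fun h => absurd rfl h⟩
    · exact ⟨fun h => absurd h (by decide), fun _ => by norm_num⟩
    · exact absurd rfl hℓq
    · exact ⟨fun h => absurd h (by decide), fun _ => by norm_num⟩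
  · have hh : Literature.NumberTheory.QuadraticFields.BinaryQuadraticForm.classNumber (-(71 : ℕ) : ℤ) = 7 := by
      decide +kernel
    rw [hh]; decide

/-- **The Eisenstein half for `145146q1` at `5`, both signs, MODULO ONLY the scoped binder** (class X6 read off the
model: `classX6_of_intModel` with `card_c145146q1_5`). CONDITIONAL; per pair; closes nothing.
[claim: BurungaleSkinnerTianWan2024, status: under-review] [cite: Cremona2006, Table 1 (Cremona label 145146q1)] -/
theorem kobayashiLowerDivisibility_c145146q1_5_of_thm13_scoped_OPEN
    (hBSTW : BurungaleSkinnerTianWan2024_thm13_scoped_OPEN)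
    {W : WeierstrassCurve ℚ} [W.IsElliptic] [W.IsGloballyMinimal]
    (hWeq : W = ⟨1, 0, 1, -3229945761, -70654953055340⟩) (ε : ℤˣ) :
    haveI : Fact (Nat.Prime 5) := ⟨by norm_num⟩
    Summit.BirchSwinnertonDyer.Rank1Residual.Supersingular.KobayashiLowerDivisibility W 5 ε := by
  haveI : Fact (Nat.Prime 5) := ⟨by norm_num⟩
  have hIW : integralModelInt W = ⟨1, 0, 1, -3229945761, -70654953055340⟩ :=
    integralModelInt_eq_of_map_eq _ (by rw [hWeq]; ext <;> simp [WeierstrassCurve.map])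
  have hX : ClassX6 W 5 :=
    classX6_of_intModel 5 le_rfl hIW (by decide +kernel) card_c145146q1_5 (by decide) (by decide +kernel)
  exact X6.kobayashiLowerDivisibility_of_thm13_scoped_OPEN W 5 hBSTW le_rfl hX
    (BSTWScope_hasWitness_c145146q1_5 hWeq) ε

/-! ### `236810a1 @ 13` -/

/-- `#Ẽ(𝔽_13) = 14` for `236810a1` (`a_13 = 0`: good SUPERSINGULAR at `13`; kernel count). [folklore] -/
theorem card_c236810a1_13 :
    Nat.card (((⟨1, 0, 1, -3898227707063, -2962435984809333492⟩ : WeierstrassCurve ℤ).map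
      (Int.castRingHom (ZMod 13))).toAffine.Point) = 14 :=
  haveI : Fact (Nat.Prime 13) := ⟨by norm_num⟩
  natCard_point_eq_of_countPoints 1 0 1 (-3898227707063) (-2962435984809333492) 13 (by norm_num) (by decide +kernel)
    (by decide +kernel)

/-- **L-witness for `236810a1` at `p = 13`: `q = 17`, `L = ℚ(√−439)` (`h = 15`)** — `N = 2·5·7·17·199`, `Δ_min = −2·5·7¹⁷·17⁸·199³`,
`ord_17 Δ = 8` (`13 ∤ 8`). Unconditional; per pair; closes nothing.
[cite: Cremona2006, Table 1 (Cremona label 236810a1)] [cite: Cox2013, Thm. 2.13 (h(−439) = 15 by reduced forms)] -/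
theorem BSTWScope_hasWitness_c236810a1_13 {W : WeierstrassCurve ℚ} [W.IsElliptic] [W.IsGloballyMinimal]
    (hWeq : W = ⟨1, 0, 1, -3898227707063, -2962435984809333492⟩) :
    haveI : Fact (Nat.Prime 13) := ⟨by norm_num⟩
    BSTWScope.HasWitness W 13 := by
  haveI : Fact (Nat.Prime 13) := ⟨by norm_num⟩
  haveI hq : Fact (Nat.Prime 17) := ⟨by norm_num⟩
  have hIW : integralModelInt W = ⟨1, 0, 1, -3898227707063, -2962435984809333492⟩ :=
    integralModelInt_eq_of_map_eq _ (by rw [hWeq]; ext <;> simp [WeierstrassCurve.map])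
  set Lp : List ℕ := [2, 5, 7, 17, 199] with hLp
  have hLprime : ∀ q ∈ Lp, q.Prime := by
    simp only [hLp, List.mem_cons, List.mem_nil_iff, or_false]
    rintro q (rfl | rfl | rfl | rfl | rfl) <;> norm_num
  have hΔE : ∀ q : ℕ, q.Prime → (q : ℤ) ∣ (⟨1, 0, 1, -3898227707063, -2962435984809333492⟩ : WeierstrassCurve ℤ).Δ → q ∈ Lp :=
    forall_mem_of_natAbs_eq_prod_pow Lp [1, 1, 17, 8, 3] hLprime (by decide +kernel)
  have hbadmem : ∀ ℓ : ℕ, (hℓ : ℓ.Prime) →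
      (haveI : Fact ℓ.Prime := ⟨hℓ⟩; ¬ W.HasGoodReductionAtPrime ℓ) → ℓ ∈ Lp := by
    intro ℓ hℓ hbad
    haveI : Fact ℓ.Prime := ⟨hℓ⟩
    have hd := natCast_dvd_minimalDiscriminantInt_of_not_hasGoodReductionAtPrime (W := W) ℓ hbad
    rw [minimalDiscriminantInt_eq hIW] at hd
    exact hΔE ℓ hℓ hd
  have haux : BSTWScope.IsAuxiliaryPrime W 13 17 := by
    refine ⟨by decide, hasMultiplicativeReductionAtPrime_of_intModel hIW 17 (by decide +kernel)
      (by decide +kernel), ?_⟩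
    rw [minimalDiscriminantInt_eq hIW,
      padicValInt_eq_of_dvd_of_not_dvd 17 (e := 8) (by decide +kernel) (by decide +kernel)]
    decide
  refine BSTWScope.hasWitness_of_kronecker W 13 (by decide) 17 haux 439 ⟨by norm_num, ?_, by norm_num⟩
    (by norm_num) (by norm_num) ?_ ?_ (fun _ => by norm_num) ?_
  · exact Int.squarefree_natAbs.mp (by simpa using (by norm_num : Nat.Prime 439).squarefree)
  · intro ℓ hℓ hbad
    have hmem := hbadmem ℓ hℓ hbad
    simp only [hLp, List.mem_cons, List.mem_nil_iff, or_false] at hmem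
    rcases hmem with rfl | rfl | rfl | rfl | rfl <;> decide
  · intro ℓ hℓ hℓq hbad
    have hmem := hbadmem ℓ hℓ hbad
    simp only [hLp, List.mem_cons, List.mem_nil_iff, or_false] at hmem
    rcases hmem with rfl | rfl | rfl | rfl | rfl
    · exact ⟨fun _ => by norm_num, fun h => absurd rfl h⟩
    · exact ⟨fun h => absurd h (by decide), fun _ => by norm_num⟩
    · exact ⟨fun h => absurd h (by decide), fun _ => by norm_num⟩
    · exact absurd rfl hℓq
    · exact ⟨fun h => absurd h (by decide), fun _ => by norm_num⟩
  · have hh : Literature.NumberTheory.QuadraticFields.BinaryQuadraticForm.classNumber (-(439 : ℕ) : ℤ) = 15 := by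
      decide +kernel
    rw [hh]; decide

/-- **The Eisenstein half for `236810a1` at `13`, both signs, MODULO ONLY the scoped binder** (class X6 read off the
model: `classX6_of_intModel` with `card_c236810a1_13`). CONDITIONAL; per pair; closes nothing.
[claim: BurungaleSkinnerTianWan2024, status: under-review] [cite: Cremona2006, Table 1 (Cremona label 236810a1)] -/
theorem kobayashiLowerDivisibility_c236810a1_13_of_thm13_scoped_OPEN
    (hBSTW : BurungaleSkinnerTianWan2024_thm13_scoped_OPEN)
    {W : WeierstrassCurve ℚ} [W.IsElliptic] [W.IsGloballyMinimal]
    (hWeq : W = ⟨1, 0, 1, -3898227707063, -2962435984809333492⟩) (ε : ℤˣ) :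
    haveI : Fact (Nat.Prime 13) := ⟨by norm_num⟩
    Summit.BirchSwinnertonDyer.Rank1Residual.Supersingular.KobayashiLowerDivisibility W 13 ε := by
  haveI : Fact (Nat.Prime 13) := ⟨by norm_num⟩
  have hIW : integralModelInt W = ⟨1, 0, 1, -3898227707063, -2962435984809333492⟩ :=
    integralModelInt_eq_of_map_eq _ (by rw [hWeq]; ext <;> simp [WeierstrassCurve.map])
  have hX : ClassX6 W 13 :=
    classX6_of_intModel 13 (by norm_num) hIW (by decide +kernel) card_c236810a1_13 (by decide) (by decide +kernel)
  exact X6.kobayashiLowerDivisibility_of_thm13_scoped_OPEN W 13 hBSTW (by norm_num) hX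
    (BSTWScope_hasWitness_c236810a1_13 hWeq) ε

/-! ### `297402n1 @ 11` -/

/-- `#Ẽ(𝔽_11) = 12` for `297402n1` (`a_11 = 0`: good SUPERSINGULAR at `11`; kernel count). [folklore] -/
theorem card_c297402n1_11 :
    Nat.card (((⟨1, 0, 1, -227376922, -1319696067412⟩ : WeierstrassCurve ℤ).map
      (Int.castRingHom (ZMod 11))).toAffine.Point) = 12 :=
  haveI : Fact (Nat.Prime 11) := ⟨by norm_num⟩
  natCard_point_eq_of_countPoints 1 0 1 (-227376922) (-1319696067412) 11 (by norm_num) (by decide +kernel)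
    (by decide +kernel)

/-- **L-witness for `297402n1` at `p = 11`: `q = 97`, `L = ℚ(√−215)` (`h = 14`; `215 = 5·43`)** — `N = 2·3·7·73·97`,
`Δ_min = −2⁵·3·7¹⁰·73·97`, `ord_97 Δ = 1` (`11 ∤ 1`). Unconditional; per pair; closes nothing.
[cite: Cremona2006, Table 1 (Cremona label 297402n1)] [cite: Cox2013, Thm. 2.13 (h(−215) = 14 by reduced forms)] -/
theorem BSTWScope_hasWitness_c297402n1_11 {W : WeierstrassCurve ℚ} [W.IsElliptic] [W.IsGloballyMinimal]
    (hWeq : W = ⟨1, 0, 1, -227376922, -1319696067412⟩) :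
    haveI : Fact (Nat.Prime 11) := ⟨by norm_num⟩
    BSTWScope.HasWitness W 11 := by
  haveI : Fact (Nat.Prime 11) := ⟨by norm_num⟩
  haveI hq : Fact (Nat.Prime 97) := ⟨by norm_num⟩
  have hIW : integralModelInt W = ⟨1, 0, 1, -227376922, -1319696067412⟩ :=
    integralModelInt_eq_of_map_eq _ (by rw [hWeq]; ext <;> simp [WeierstrassCurve.map])
  set Lp : List ℕ := [2, 3, 7, 73, 97] with hLp
  have hLprime : ∀ q ∈ Lp, q.Prime := by
    simp only [hLp, List.mem_cons, List.mem_nil_iff, or_false]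
    rintro q (rfl | rfl | rfl | rfl | rfl) <;> norm_num
  have hΔE : ∀ q : ℕ, q.Prime → (q : ℤ) ∣ (⟨1, 0, 1, -227376922, -1319696067412⟩ : WeierstrassCurve ℤ).Δ → q ∈ Lp :=
    forall_mem_of_natAbs_eq_prod_pow Lp [5, 1, 10, 1, 1] hLprime (by decide +kernel)
  have hbadmem : ∀ ℓ : ℕ, (hℓ : ℓ.Prime) →
      (haveI : Fact ℓ.Prime := ⟨hℓ⟩; ¬ W.HasGoodReductionAtPrime ℓ) → ℓ ∈ Lp := by
    intro ℓ hℓ hbad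
    haveI : Fact ℓ.Prime := ⟨hℓ⟩
    have hd := natCast_dvd_minimalDiscriminantInt_of_not_hasGoodReductionAtPrime (W := W) ℓ hbad
    rw [minimalDiscriminantInt_eq hIW] at hd
    exact hΔE ℓ hℓ hd
  have haux : BSTWScope.IsAuxiliaryPrime W 11 97 := by
    refine ⟨by decide, hasMultiplicativeReductionAtPrime_of_intModel hIW 97 (by decide +kernel)
      (by decide +kernel), ?_⟩
    rw [minimalDiscriminantInt_eq hIW,
      padicValInt_eq_of_dvd_of_not_dvd 97 (e := 1) (by decide +kernel) (by decide +kernel)]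
    decide
  refine BSTWScope.hasWitness_of_kronecker W 11 (by decide) 97 haux 215 ⟨by norm_num, ?_, by norm_num⟩
    (by norm_num) (by norm_num) ?_ ?_ (fun _ => by norm_num) ?_
  · exact Int.squarefree_natAbs.mp (by simpa using (show Squarefree (215 : ℕ) by decide +kernel))
  · intro ℓ hℓ hbad
    have hmem := hbadmem ℓ hℓ hbad
    simp only [hLp, List.mem_cons, List.mem_nil_iff, or_false] at hmem
    rcases hmem with rfl | rfl | rfl | rfl | rfl <;> decide
  · intro ℓ hℓ hℓq hbad
    have hmem := hbadmem ℓ hℓ hbad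
    simp only [hLp, List.mem_cons, List.mem_nil_iff, or_false] at hmem
    rcases hmem with rfl | rfl | rfl | rfl | rfl
    · exact ⟨fun _ => by norm_num, fun h => absurd rfl h⟩
    · exact ⟨fun h => absurd h (by decide), fun _ => by norm_num⟩
    · exact ⟨fun h => absurd h (by decide), fun _ => by norm_num⟩
    · exact ⟨fun h => absurd h (by decide), fun _ => by norm_num⟩
    · exact absurd rfl hℓq
  · have hh : Literature.NumberTheory.QuadraticFields.BinaryQuadraticForm.classNumber (-(215 : ℕ) : ℤ) = 14 := by
      decide +kernel
    rw [hh]; decide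

/-- **The Eisenstein half for `297402n1` at `11`, both signs, MODULO ONLY the scoped binder** (class X6 read off the
model: `classX6_of_intModel` with `card_c297402n1_11`). CONDITIONAL; per pair; closes nothing.
[claim: BurungaleSkinnerTianWan2024, status: under-review] [cite: Cremona2006, Table 1 (Cremona label 297402n1)] -/
theorem kobayashiLowerDivisibility_c297402n1_11_of_thm13_scoped_OPEN
    (hBSTW : BurungaleSkinnerTianWan2024_thm13_scoped_OPEN)
    {W : WeierstrassCurve ℚ} [W.IsElliptic] [W.IsGloballyMinimal]
    (hWeq : W = ⟨1, 0, 1, -227376922, -1319696067412⟩) (ε : ℤˣ) :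
    haveI : Fact (Nat.Prime 11) := ⟨by norm_num⟩
    Summit.BirchSwinnertonDyer.Rank1Residual.Supersingular.KobayashiLowerDivisibility W 11 ε := by
  haveI : Fact (Nat.Prime 11) := ⟨by norm_num⟩
  have hIW : integralModelInt W = ⟨1, 0, 1, -227376922, -1319696067412⟩ :=
    integralModelInt_eq_of_map_eq _ (by rw [hWeq]; ext <;> simp [WeierstrassCurve.map])
  have hX : ClassX6 W 11 :=
    classX6_of_intModel 11 (by norm_num) hIW (by decide +kernel) card_c297402n1_11 (by decide) (by decide +kernel)
  exact X6.kobayashiLowerDivisibility_of_thm13_scoped_OPEN W 11 hBSTW (by norm_num) hX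
    (BSTWScope_hasWitness_c297402n1_11 hWeq) ε

/-! ### `421511a1 @ 13` -/

/-- `#Ẽ(𝔽_13) = 14` for `421511a1` (`a_13 = 0`: good SUPERSINGULAR at `13`; kernel count). [folklore] -/
theorem card_c421511a1_13 :
    Nat.card (((⟨0, 1, 1, -1539789408, -23256785654145⟩ : WeierstrassCurve ℤ).map
      (Int.castRingHom (ZMod 13))).toAffine.Point) = 14 :=
  haveI : Fact (Nat.Prime 13) := ⟨by norm_num⟩
  natCard_point_eq_of_countPoints 0 1 1 (-1539789408) (-23256785654145) 13 (by norm_num) (by decide +kernel)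
    (by decide +kernel)

/-- **L-witness for `421511a1` at `p = 13`: `q = 307`, `L = ℚ(√−103)` (`h = 5`)** — `N = 307·1373`, `Δ_min = −307³·1373²`,
`ord_307 Δ = 3` (`13 ∤ 3`). Unconditional; per pair; closes nothing.
[cite: Cremona2006, Table 1 (Cremona label 421511a1)] [cite: Cox2013, Thm. 2.13 (h(−103) = 5 by reduced forms)] -/
theorem BSTWScope_hasWitness_c421511a1_13 {W : WeierstrassCurve ℚ} [W.IsElliptic] [W.IsGloballyMinimal]
    (hWeq : W = ⟨0, 1, 1, -1539789408, -23256785654145⟩) :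
    haveI : Fact (Nat.Prime 13) := ⟨by norm_num⟩
    BSTWScope.HasWitness W 13 := by
  haveI : Fact (Nat.Prime 13) := ⟨by norm_num⟩
  haveI hq : Fact (Nat.Prime 307) := ⟨by norm_num⟩
  have hIW : integralModelInt W = ⟨0, 1, 1, -1539789408, -23256785654145⟩ :=
    integralModelInt_eq_of_map_eq _ (by rw [hWeq]; ext <;> simp [WeierstrassCurve.map])
  set Lp : List ℕ := [307, 1373] with hLp
  have hLprime : ∀ q ∈ Lp, q.Prime := by
    simp only [hLp, List.mem_cons, List.mem_nil_iff, or_false]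
    rintro q (rfl | rfl) <;> norm_num
  have hΔE : ∀ q : ℕ, q.Prime → (q : ℤ) ∣ (⟨0, 1, 1, -1539789408, -23256785654145⟩ : WeierstrassCurve ℤ).Δ → q ∈ Lp :=
    forall_mem_of_natAbs_eq_prod_pow Lp [3, 2] hLprime (by decide +kernel)
  have hbadmem : ∀ ℓ : ℕ, (hℓ : ℓ.Prime) →
      (haveI : Fact ℓ.Prime := ⟨hℓ⟩; ¬ W.HasGoodReductionAtPrime ℓ) → ℓ ∈ Lp := by
    intro ℓ hℓ hbad
    haveI : Fact ℓ.Prime := ⟨hℓ⟩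
    have hd := natCast_dvd_minimalDiscriminantInt_of_not_hasGoodReductionAtPrime (W := W) ℓ hbad
    rw [minimalDiscriminantInt_eq hIW] at hd
    exact hΔE ℓ hℓ hd
  have haux : BSTWScope.IsAuxiliaryPrime W 13 307 := by
    refine ⟨by decide, hasMultiplicativeReductionAtPrime_of_intModel hIW 307 (by decide +kernel)
      (by decide +kernel), ?_⟩
    rw [minimalDiscriminantInt_eq hIW,
      padicValInt_eq_of_dvd_of_not_dvd 307 (e := 3) (by decide +kernel) (by decide +kernel)]
    decide
  refine BSTWScope.hasWitness_of_kronecker W 13 (by decide) 307 haux 103 ⟨by norm_num, ?_, by norm_num⟩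
    (by norm_num) (by norm_num) ?_ ?_ (fun _ => by norm_num) ?_
  · exact Int.squarefree_natAbs.mp (by simpa using (by norm_num : Nat.Prime 103).squarefree)
  · intro ℓ hℓ hbad
    have hmem := hbadmem ℓ hℓ hbad
    simp only [hLp, List.mem_cons, List.mem_nil_iff, or_false] at hmem
    rcases hmem with rfl | rfl <;> decide
  · intro ℓ hℓ hℓq hbad
    have hmem := hbadmem ℓ hℓ hbad
    simp only [hLp, List.mem_cons, List.mem_nil_iff, or_false] at hmem
    rcases hmem with rfl | rfl
    · exact absurd rfl hℓq
    · exact ⟨fun h => absurd h (by decide), fun _ => by norm_num⟩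
  · have hh : Literature.NumberTheory.QuadraticFields.BinaryQuadraticForm.classNumber (-(103 : ℕ) : ℤ) = 5 := by
      decide +kernel
    rw [hh]; decide

/-- **The Eisenstein half for `421511a1` at `13`, both signs, MODULO ONLY the scoped binder** (class X6 read off the
model: `classX6_of_intModel` with `card_c421511a1_13`). CONDITIONAL; per pair; closes nothing.
[claim: BurungaleSkinnerTianWan2024, status: under-review] [cite: Cremona2006, Table 1 (Cremona label 421511a1)] -/
theorem kobayashiLowerDivisibility_c421511a1_13_of_thm13_scoped_OPEN
    (hBSTW : BurungaleSkinnerTianWan2024_thm13_scoped_OPEN)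
    {W : WeierstrassCurve ℚ} [W.IsElliptic] [W.IsGloballyMinimal]
    (hWeq : W = ⟨0, 1, 1, -1539789408, -23256785654145⟩) (ε : ℤˣ) :
    haveI : Fact (Nat.Prime 13) := ⟨by norm_num⟩
    Summit.BirchSwinnertonDyer.Rank1Residual.Supersingular.KobayashiLowerDivisibility W 13 ε := by
  haveI : Fact (Nat.Prime 13) := ⟨by norm_num⟩
  have hIW : integralModelInt W = ⟨0, 1, 1, -1539789408, -23256785654145⟩ :=
    integralModelInt_eq_of_map_eq _ (by rw [hWeq]; ext <;> simp [WeierstrassCurve.map])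
  have hX : ClassX6 W 13 :=
    classX6_of_intModel 13 (by norm_num) hIW (by decide +kernel) card_c421511a1_13 (by decide) (by decide +kernel)
  exact X6.kobayashiLowerDivisibility_of_thm13_scoped_OPEN W 13 hBSTW (by norm_num) hX
    (BSTWScope_hasWitness_c421511a1_13 hWeq) ε

end Summit.BirchSwinnertonDyer.BirchSwinnertonDyer.Theorems

end
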